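/-
Copyright: the b2b-balaban T⁴-continuum CRUX team, row NE7b OWNER lineage `t4-ne7b-p1` (gen 105). Project licence.
-/
import Summits.QuantumFields.BalabanUV.T4Continuum.Spine.NE7b.GaussianRestrictedMoment
import Mathlib.MeasureTheory.Integral.Prod

/-!
# DECOUPLING IN THE BLOCK-DIAGONAL GAUSSIAN MODEL: far blocks — their couplings AND their characteristic functions — cancel EXACTLY
# between the numerator and the denominator of the restricted moment (row NE7b, node U5c; the model form of residual (R1))

Cell `pub-balaban`, sub-cell `t4`, spine estimate NE7b (`T4WeightBudget.RelWeightBound`; the cell's OWN estimate — NOT PRINTED in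
[Bałaban 1983–89], NOT PROVED).  Crux-route work under `Spine/NE7b/` by the row's OWNER; NOTHING of Bałaban's is named or asserted;
no `T4Continuum/Support` leaf typed; zero `sorry`.

WHY (refuter κ-ne7bref-g65-1 on `…GaussianRestrictedMoment`, ADOPTED by the owner W-ne7bp1-g105-1 (D)).  The restricted-moment bound
`(√(1−δ))⁻¹ ^ r ∕ (1 − η)` is VOLUME-SAFE only if the characteristic function `F` collects the large-field conditions of a BOUNDED
neighbourhood of the pinned region: the union bound `η ≤ Σ_{b ∈ B} e^{−θ_b}(√(1−δ))⁻¹^{r_b}` carries `#B`, and print's restriction at a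
step is a product over ALL blocks of the lattice.  Removing the far blocks from numerator AND denominator is a DECOUPLING step — residual
(R1) of the (A1c) LCS instance (finite range ∕ exponential decay of the fluctuation covariance + the localised 𝐑-operation, [Balaban1989
LargeFieldI] §1).  THIS FILE proves (R1) in the model where the decoupling is EXACT: a block-diagonal form `S = S₁ ⊕ S₂` (no coupling
between the near variables `n₁` and the far variables `n₂`), a sacrificed form `Q = Q₁ ⊕ 0` on the near block, and a product
restriction `F(x) = F₁(x₁)·F₂(x₂)`.  Then by Fubini the far factor `∫ F₂ e^{−S₂}` appears in numerator and denominator alike and CANCELS: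
the restricted moment of the whole equals that of the near block, so `η` counts the NEAR block's conditions only — uniformly in the
volume `#n₂` and whatever `F₂` is (any far large-field structure).  For a covariance with exponentially decaying (not vanishing)
off-diagonal blocks the cancellation is up to `e^{O(#∂)}` by a cluster expansion — NOT here.

WHAT IS PROVED ([folklore]; Mathlib `measurePreserving_sumPiEquivProdPi_symm` + `integral_prod_mul`):
* §1 `integral_mul_comp_inl_inr` (`∫ g₁(x∘inl)·g₂(x∘inr) dx = (∫ g₁)(∫ g₂)` on `(n₁ ⊕ n₂) → ℝ`), `qf_fromBlocks_diag`
  (`xᵀ(S₁ ⊕ S₂)x = x₁ᵀS₁x₁ + x₂ᵀS₂x₂`), `qf_fromBlocks_near` (`xᵀ(Q₁ ⊕ 0)x = x₁ᵀQ₁x₁`).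
* §2 **`restricted_numerator_eq`**, **`restricted_denominator_eq`** (both factor through the far Gaussian mass `∫ F₂ e^{−S₂}`),
  **`restrictedMoment_decouples`** (THE CANCELLATION: the whole restricted moment EQUALS the near block's), and
  **`restrictedMoment_le_near`** (hence `≤ (√(1−δ))⁻¹ ^ r ∕ (1 − η₁)` with `η₁` the NEAR block's large-field mass — the far block's
  conditions, however many, cost nothing).

NOT HERE (honest): non-block-diagonal covariances (the cluster-expansion form of (R1)); the non-Gaussian remainder (R2); anything of
Bałaban's.  NE7b NOT PRINTED ∕ NOT PROVED; spine PROVED 0∕9; rung (B)+1 on a FINITE torus — NOT infinite volume, NOT the mass gap, NOT Clay.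
HONEST DEPENDENCY: continuum YM on T⁴ ⇐ BetaPertH ∧ nine spine estimates (0/9 proved); BetaPertH ⇐ (D1) ∧ (D4) ∧ CAP+tail.
-/

set_option autoImplicit false

open Matrix Finset MeasureTheory Real
open Summit.QuantumFields.BalabanUV.T4Continuum.NE7b.QuadFormSimDiag
open Summit.QuantumFields.BalabanUV.T4Continuum.NE7b.GaussianDominatedMoment
open Summit.QuantumFields.BalabanUV.T4Continuum.NE7b.GaussianRestrictedMoment

namespace Summit.QuantumFields.BalabanUV.T4Continuum.NE7b.GaussianBlockDecoupling

variable {n₁ n₂ : Type} [Fintype n₁] [Fintype n₂] [DecidableEq n₁] [DecidableEq n₂]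

/-! ## §1 Fubini across the two blocks, and block quadratic forms -/

omit [DecidableEq n₁] [DecidableEq n₂] in
/-- **FUBINI ACROSS THE BLOCKS**: a function of the near variables times a function of the far variables integrates to the product
of the integrals (Lebesgue measure on `(n₁ ⊕ n₂) → ℝ`; no integrability needed, by the conventions of the Bochner integral). [folklore] -/
theorem integral_mul_comp_inl_inr (g₁ : (n₁ → ℝ) → ℝ) (g₂ : (n₂ → ℝ) → ℝ) :
    ∫ x : n₁ ⊕ n₂ → ℝ, g₁ (fun i => x (Sum.inl i)) * g₂ (fun i => x (Sum.inr i)) =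
      (∫ y : n₁ → ℝ, g₁ y) * ∫ y : n₂ → ℝ, g₂ y := by
  have hmp := volume_measurePreserving_sumPiEquivProdPi_symm (fun _ : n₁ ⊕ n₂ => ℝ)
  rw [← hmp.integral_comp (MeasurableEquiv.measurableEmbedding _), MeasureTheory.Measure.volume_eq_prod]
  have e1 : ∀ p : (n₁ → ℝ) × (n₂ → ℝ),
      (fun i => (MeasurableEquiv.sumPiEquivProdPi fun _ : n₁ ⊕ n₂ => ℝ).symm p (Sum.inl i)) = p.1 := fun p => rfl
  have e2 : ∀ p : (n₁ → ℝ) × (n₂ → ℝ),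
      (fun i => (MeasurableEquiv.sumPiEquivProdPi fun _ : n₁ ⊕ n₂ => ℝ).symm p (Sum.inr i)) = p.2 := fun p => rfl
  simp_rw [e1, e2]
  exact integral_prod_mul g₁ g₂

omit [DecidableEq n₁] [DecidableEq n₂] in
/-- The quadratic form of a block-diagonal matrix splits. [folklore] -/
theorem qf_fromBlocks_diag (S₁ : Matrix n₁ n₁ ℝ) (S₂ : Matrix n₂ n₂ ℝ) (x : n₁ ⊕ n₂ → ℝ) :
    x ⬝ᵥ (Matrix.fromBlocks S₁ 0 0 S₂ *ᵥ x) =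
      (fun i => x (Sum.inl i)) ⬝ᵥ (S₁ *ᵥ fun i => x (Sum.inl i)) +
        (fun i => x (Sum.inr i)) ⬝ᵥ (S₂ *ᵥ fun i => x (Sum.inr i)) := by
  rw [fromBlocks_mulVec, dotProduct, Fintype.sum_sum_type]
  simp only [Sum.elim_inl, Sum.elim_inr, zero_mulVec, add_zero, zero_add, dotProduct, Function.comp_def]

omit [DecidableEq n₁] [DecidableEq n₂] in
/-- The quadratic form of a matrix living on the near block. [folklore] -/
theorem qf_fromBlocks_near (Q₁ : Matrix n₁ n₁ ℝ) (x : n₁ ⊕ n₂ → ℝ) :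
    x ⬝ᵥ (Matrix.fromBlocks Q₁ 0 0 (0 : Matrix n₂ n₂ ℝ) *ᵥ x) =
      (fun i => x (Sum.inl i)) ⬝ᵥ (Q₁ *ᵥ fun i => x (Sum.inl i)) := by
  rw [qf_fromBlocks_diag, zero_mulVec, dotProduct_zero, add_zero]

/-! ## §2 The cancellation of the far block -/

section Decoupling

variable (S₁ Q₁ : Matrix n₁ n₁ ℝ) (S₂ : Matrix n₂ n₂ ℝ) (F₁ : (n₁ → ℝ) → ℝ) (F₂ : (n₂ → ℝ) → ℝ)

omit [DecidableEq n₁] [DecidableEq n₂] in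
/-- **THE NUMERATOR FACTORS**: `∫ F₁(x₁)F₂(x₂)·e^{xᵀ(Q₁⊕0)x}·e^{−xᵀ(S₁⊕S₂)x} dx = (∫ F₁ e^{Q₁} e^{−S₁}) · (∫ F₂ e^{−S₂})`. [folklore] -/
theorem restricted_numerator_eq :
    ∫ x : n₁ ⊕ n₂ → ℝ, (F₁ (fun i => x (Sum.inl i)) * F₂ (fun i => x (Sum.inr i))) *
        (exp (x ⬝ᵥ (Matrix.fromBlocks Q₁ 0 0 (0 : Matrix n₂ n₂ ℝ) *ᵥ x)) *
          exp (-(x ⬝ᵥ (Matrix.fromBlocks S₁ 0 0 S₂ *ᵥ x)))) =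
      (∫ y : n₁ → ℝ, F₁ y * (exp (y ⬝ᵥ (Q₁ *ᵥ y)) * exp (-(y ⬝ᵥ (S₁ *ᵥ y))))) *
        ∫ y : n₂ → ℝ, F₂ y * exp (-(y ⬝ᵥ (S₂ *ᵥ y))) := by
  rw [← integral_mul_comp_inl_inr]
  refine integral_congr_ae (Filter.Eventually.of_forall fun x => ?_)
  beta_reduce
  rw [qf_fromBlocks_near, qf_fromBlocks_diag, neg_add, exp_add]
  ring

omit [DecidableEq n₁] [DecidableEq n₂] in
/-- **THE DENOMINATOR FACTORS**: `∫ F₁(x₁)F₂(x₂)·e^{−xᵀ(S₁⊕S₂)x} dx = (∫ F₁ e^{−S₁}) · (∫ F₂ e^{−S₂})`. [folklore] -/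
theorem restricted_denominator_eq :
    ∫ x : n₁ ⊕ n₂ → ℝ, (F₁ (fun i => x (Sum.inl i)) * F₂ (fun i => x (Sum.inr i))) *
        exp (-(x ⬝ᵥ (Matrix.fromBlocks S₁ 0 0 S₂ *ᵥ x))) =
      (∫ y : n₁ → ℝ, F₁ y * exp (-(y ⬝ᵥ (S₁ *ᵥ y)))) * ∫ y : n₂ → ℝ, F₂ y * exp (-(y ⬝ᵥ (S₂ *ᵥ y))) := by
  rw [← integral_mul_comp_inl_inr]
  refine integral_congr_ae (Filter.Eventually.of_forall fun x => ?_)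
  beta_reduce
  rw [qf_fromBlocks_diag, neg_add, exp_add]
  ring

omit [DecidableEq n₁] [DecidableEq n₂] in
/-- **THE FAR BLOCK CANCELS** (decoupling, exact in the block-diagonal model): whenever the far restricted Gaussian mass
`∫ F₂ e^{−S₂}` is non-zero, the restricted moment of the WHOLE equals the restricted moment of the NEAR block —
whatever the far block's size `#n₂`, form `S₂` and characteristic function `F₂`. [folklore] -/
theorem restrictedMoment_decouples (h₂ : (∫ y : n₂ → ℝ, F₂ y * exp (-(y ⬝ᵥ (S₂ *ᵥ y)))) ≠ 0) :
    (∫ x : n₁ ⊕ n₂ → ℝ, (F₁ (fun i => x (Sum.inl i)) * F₂ (fun i => x (Sum.inr i))) *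
        (exp (x ⬝ᵥ (Matrix.fromBlocks Q₁ 0 0 (0 : Matrix n₂ n₂ ℝ) *ᵥ x)) *
          exp (-(x ⬝ᵥ (Matrix.fromBlocks S₁ 0 0 S₂ *ᵥ x))))) /
      (∫ x : n₁ ⊕ n₂ → ℝ, (F₁ (fun i => x (Sum.inl i)) * F₂ (fun i => x (Sum.inr i))) *
        exp (-(x ⬝ᵥ (Matrix.fromBlocks S₁ 0 0 S₂ *ᵥ x)))) =
      (∫ y : n₁ → ℝ, F₁ y * (exp (y ⬝ᵥ (Q₁ *ᵥ y)) * exp (-(y ⬝ᵥ (S₁ *ᵥ y))))) /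
        ∫ y : n₁ → ℝ, F₁ y * exp (-(y ⬝ᵥ (S₁ *ᵥ y))) := by
  rw [restricted_numerator_eq, restricted_denominator_eq, mul_div_mul_right _ _ h₂]

omit [DecidableEq n₂] in
/-- **HENCE THE NEAR BLOCK's PRICE ONLY**: with the near data `δ`-dominated of rank `≤ r` and the NEAR characteristic function's
large-field mass `≤ η₁·∫e^{−S₁}` (`η₁ < 1`), and a far restricted mass that is merely non-zero, the whole restricted moment is
`≤ (√(1−δ))⁻¹ ^ r ∕ (1 − η₁)` — the far block's conditions, however many, do not enter. [folklore] -/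
theorem restrictedMoment_le_near {δ η₁ : ℝ} {r : ℕ} (hS₁ : S₁.PosDef) (hQ₁ : Q₁.PosSemidef) (hdom : (δ • S₁ - Q₁).PosSemidef)
    (hδ0 : 0 ≤ δ) (hδ : δ < 1) (hr : Q₁.rank ≤ r) (hF0 : ∀ y, 0 ≤ F₁ y) (hF1 : ∀ y, F₁ y ≤ 1)
    (hFm : AEStronglyMeasurable F₁ volume) (hη : η₁ < 1)
    (hmass : ∫ y, (1 - F₁ y) * exp (-(y ⬝ᵥ (S₁ *ᵥ y))) ≤ η₁ * ∫ y, exp (-(y ⬝ᵥ (S₁ *ᵥ y))))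
    (h₂ : (∫ y : n₂ → ℝ, F₂ y * exp (-(y ⬝ᵥ (S₂ *ᵥ y)))) ≠ 0) :
    (∫ x : n₁ ⊕ n₂ → ℝ, (F₁ (fun i => x (Sum.inl i)) * F₂ (fun i => x (Sum.inr i))) *
        (exp (x ⬝ᵥ (Matrix.fromBlocks Q₁ 0 0 (0 : Matrix n₂ n₂ ℝ) *ᵥ x)) *
          exp (-(x ⬝ᵥ (Matrix.fromBlocks S₁ 0 0 S₂ *ᵥ x))))) /
      (∫ x : n₁ ⊕ n₂ → ℝ, (F₁ (fun i => x (Sum.inl i)) * F₂ (fun i => x (Sum.inr i))) *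
        exp (-(x ⬝ᵥ (Matrix.fromBlocks S₁ 0 0 S₂ *ᵥ x)))) ≤
      (√(1 - δ))⁻¹ ^ r / (1 - η₁) := by
  rw [restrictedMoment_decouples S₁ Q₁ S₂ F₁ F₂ h₂]
  exact restrictedGaussianMoment_le hS₁ hQ₁ hdom hδ0 hδ hr hF0 hF1 hFm hη hmass

end Decoupling

end Summit.QuantumFields.BalabanUV.T4Continuum.NE7b.GaussianBlockDecoupling
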